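import Literature.NumberTheory.DiophantineGeometry.MultiplicativeGroupApproximationThm328Proofs
import HarnessLib

/-!
# Evertse–Győry, Theorem 4.2.1 over `ℚ`: which archimedean and `p`-adic inputs suffice

Topic `NumberTheory/DiophantineGeometry`; namespace
`Literature.NumberTheory.DiophantineGeometry.Dioph`.
Companion of `MultiplicativeGroupApproximation.lean` (the named fact `evertseGyory_thm_4_2_1_rat`,
Evertse–Győry's Theorem 4.2.1 for `K = ℚ`) and of `MultiplicativeGroupApproximationThm328Proofs.lean`,
which proves `evertseGyory_thm_4_2_1_rat_of_matveev_yu`: Theorem 4.2.1 over `ℚ` from the PRINTED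
statements of Theorem 3.2.4 (Matveev 2000, Cor. 2.3) and Theorem 3.2.7 (Yu 2007) for `K = ℚ`.
Theorems only; no definition, no named fact.

## What is proved here, and why

The printed constant of Theorem 3.2.4 is `C₁(n, d) = min{(1/χ)(en/2)^χ 30^{n+3} n^{3.5}, 2^{6n+20}} d² log(ed)`
[cite: EvertseGyory2015, Thm 3.2.4 (p. 61)]. A lower bound `log |Σ| > −min{X, Y} · A₁⋯Aₙ log(eB)` is
the conjunction of the two bounds with `X` and with `Y`; and for `d = 1`, `χ = 1` one has
`(en/2) 30^{n+3} n^{3.5} < 2^{6n+20}` for EVERY `n ≥ 2` (`log` of the left side is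
`0.31 + 4.5 log n + 3.40 (n + 3)`, of the right side `4.16 n + 13.9`; at `n = 2`: `20.4 < 22.2`, and the
gap grows), so the hypothesis `hM` of `evertseGyory_thm_4_2_1_rat_of_matveev_yu` is, over `ℚ`, exactly
Matveev's SHARP bound `(en/2) 30^{n+3} n^{4.5}` — although the book's derivation of Theorem 3.2.8
(p. 63), as formalised there, uses only `min{X, Y} ≤ Y = 2^{6n+20}` (its `key` step), and at the finite
places only `C₃(n,1) · 7(n+1)² ≤ C₆(n,1)` (`const_finite_bound`).

This file records the reduction with the constants GENERALISED AWAY, by re-running the two proofs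
of `…Thm328Proofs.lean` verbatim with a parameter in place of the printed constant:

* `thm328_rat_infinite_of_archBound` — Theorem 3.2.8 over `ℚ` at the infinite place from ANY
  archimedean lower bound of the shape of Theorem 3.2.4 over `ℚ` with a constant `C(n)` satisfying
  `0 ≤ C(n) ≤ 2^{6n+20}` (`n ≥ 2`);
* `thm328_rat_finite_of_padicBound` — Theorem 3.2.8 over `ℚ` at the primes from ANY `p`-adic upper
  bound of the shape of Theorem 3.2.7 over `ℚ` (`d = 1`, `e_𝔭 = f_𝔭 = 1`, same `C₄, C₅, M, δ`) with a
  constant `C₃(n)` satisfying `0 ≤ C₃(n)` and `C₃(n) · 7(n+1)² ≤ C₆(n, 1) = λ (16e)^{3n+2}` (`n ≥ 2`);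
* `evertseGyory_thm_4_2_1_rat_of_archBound_padicBound` — the named fact from the two generic
  hypotheses (then `evertseGyory_thm_4_2_1_rat_of_thm_3_2_8`, the book's §4.4);
* `evertseGyory_thm_4_2_1_rat_of_weakMatveev_yu` — in particular the named fact follows from the
  WEAK branch alone, `log |Σ| > −2^{6n+20} A₁⋯Aₙ log(eB)` for positive rationals (the second
  expression in Matveev's Corollary 2.3), together with Yu's Theorem 3.2.7 as printed.

So a formalisation of any archimedean bound over `ℚ` with constant at most `2^{6n+20}` (in
particular one need not reproduce Matveev's `30^{n+3} n^{4.5}`), and of any `p`-adic bound of Yu's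
shape with `C₃(n) ≤ λ(16e)^{3n+2} / (7(n+1)²)` (Yu's `(16ed)^{2(n+1)} n^{3/2} log(2nd) log(2d)` has
room to spare: `(16e)^{n}` against `14(n+1)⁵`), discharges `evertseGyory_thm_4_2_1_rat`, hence
Pasten's Theorem 2.1 over `ℚ` and the Stewart–Yu bound `Literature.Barriers.ABC.BakerMethodBounds`
(see `Literature/Barriers/ABC/BakerMethodBoundsGenericInputsProofs.lean`).

## References

* [EvertseGyory2015] J.-H. Evertse, K. Győry, *Unit Equations in Diophantine Number Theory*,
  Cambridge Stud. Adv. Math. 146, CUP 2015 — Thm 3.2.4 (p. 61), Thm 3.2.7 (p. 62), Thm 3.2.8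
  (p. 62) and its proof (p. 63), Thm 4.2.1 (p. 68).
* [Matveev2000] E. M. Matveev, *An explicit lower bound for a homogeneous rational linear form in
  logarithms of algebraic numbers. II*, Izv. Math. 64 (2000), 1217–1269 — Cor. 2.3 (both expressions
  of the constant).
* [Yu2007] K. Yu, *p-adic logarithmic forms and group varieties. III*, Forum Math. 19 (2007),
  187–280 — Main Theorem, second consequence.
-/

open Height Real Finset

noncomputable section

namespace Literature.NumberTheory.DiophantineGeometry.Dioph

/-! ### The infinite place, from an archimedean bound with a generic constant -/

/-- **Evertse–Győry, Theorem 3.2.8 for `K = ℚ` at the infinite place, from an archimedean lower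
bound for linear forms in logarithms of positive rationals with ANY constant `C(n) ≤ 2^{6n+20}`.**

The hypothesis `hM` is the statement of Theorem 3.2.4 (p. 61) for `K = ℚ` exactly as in
`thm328_rat_infinite_of_matveev` (positive rationals `aₖ ≠ 1`, `n = card κ ≥ 2`, `b ≠ 0`,
`Σ = ∑ bₖ log aₖ ≠ 0`, `Aₖ ≥ max{h(aₖ), |log aₖ|, 0.16}`, `B ≥ max{1, maxₖ |bₖ| Aₖ / A_{k₀}}`,
conclusion `log |Σ| > −C(n) A₁⋯Aₙ log(eB)`), except that the printed constant
`C₁(n, 1) = min{(en/2) 30^{n+3} n^{3.5}, 2^{6n+20}}` is replaced by a parameter `C(n)` subject only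
to `0 ≤ C(n) ≤ 2^{6n+20}` for `n ≥ 2`. The conclusion is the infinite-place half of Theorem 3.2.8
for `K = ℚ` as it enters `evertseGyory_thm_4_2_1_rat_of_thm_3_2_8`. The proof is that of
`thm328_rat_infinite_of_matveev` (the book's p. 63 for `d = 1`), whose final comparison of constants
(`const_infinite_bound`: `3 · 2^{6n+20} + 2^{n−1} ≤ 2 · 2^{15n+10} ≤ (2/log 2) C₆(n,1)`) only ever
used `C₁(n,1) ≤ 2^{6n+20}`.
[cite: EvertseGyory2015, Thm 3.2.4 (p. 61), Thm 3.2.8 (p. 62), proof p. 63] -/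
theorem thm328_rat_infinite_of_archBound (C : ℕ → ℝ) (hC0 : ∀ n, 2 ≤ n → 0 ≤ C n)
    (hCle : ∀ n, 2 ≤ n → C n ≤ 2 ^ (6 * n + 20))
    (hM : ∀ (κ : Type) [Fintype κ], 2 ≤ Fintype.card κ →
      ∀ (a : κ → ℚ) (b : κ → ℤ) (A : κ → ℝ) (k₀ : κ) (B : ℝ),
        (∀ k, 0 < a k ∧ a k ≠ 1) → b ≠ 0 →
        ∑ k, (b k : ℝ) * Real.log (a k : ℝ) ≠ 0 →
        (∀ k, max (logHeight₁ (a k)) (max |Real.log (a k : ℝ)| 0.16) ≤ A k) →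
        1 ≤ B → (∀ k, (|b k| : ℝ) * A k / A k₀ ≤ B) →
        -(C (Fintype.card κ) * (∏ k, A k) * Real.log (Real.exp 1 * B)) <
          Real.log |∑ k, (b k : ℝ) * Real.log (a k : ℝ)|)
    (ι : Type) [Fintype ι] (hι : 0 < Fintype.card ι)
    (α : ι → ℚ) (hα : ∀ i, α i ≠ 0 ∧ α i ≠ 1 ∧ α i ≠ -1)
    (β : ℚ) (hβ : β ≠ 0) (s : ℤ) (hs : s = 1 ∨ s = -1) (b : ι → ℤ)
    (hΛ : (∏ i, α i ^ b i) * β ^ s - 1 ≠ 0)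
    (B : ℝ) (hbB : ∀ i, (|b i| : ℝ) ≤ B)
    (hB : 2 * Real.exp 1 * 9 ^ (Fintype.card ι + 1) * (∏ i, logHeight₁ (α i)) *
        max (logHeight₁ β) 1 ≤ B) :
    -(egC6 (Fintype.card ι + 1) * (2 / Real.log 2) * (∏ i, logHeight₁ (α i)) *
          max (logHeight₁ β) 1 * logStar (B * 2 / max (logHeight₁ β) 1)) <
      Real.log |((((∏ i, α i ^ b i) * β ^ s - 1 : ℚ)) : ℝ)| := by
  classical
  set m := Fintype.card ι with hm
  set Θ := ∏ i, logHeight₁ (α i) with hΘ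
  set H := max (logHeight₁ β) 1 with hH
  set L := logStar (B * 2 / H) with hL
  set P : ℚ := (∏ i, α i ^ b i) * β ^ s with hP
  have hm1 : 1 ≤ m := hι
  have hlog2 : 0 < Real.log 2 := Real.log_pos one_lt_two
  have hl2 : Real.log 2 ≤ 1 := by have := Real.log_two_lt_d9; linarith
  have hhalf : (1 / 2 : ℝ) ≤ Real.log 2 := by have := Real.log_two_gt_d9; linarith
  have hhα : ∀ i, Real.log 2 ≤ logHeight₁ (α i) := fun i =>
    log_two_le_logHeight₁ (hα i).1 (hα i).2.1 (hα i).2.2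
  have hΘlow : (1 / 2 : ℝ) ^ m ≤ Θ := half_pow_card_le_prod_logHeight₁ α hα
  have hΘpos : 0 < Θ := lt_of_lt_of_le (by positivity) hΘlow
  have hH1 : 1 ≤ H := le_max_right _ _
  have hH0 : 0 < H := by linarith
  have hL1 : 1 ≤ L := one_le_logStar _
  have he2 : (2 : ℝ) ≤ Real.exp 1 := by linarith [Real.add_one_le_exp (1 : ℝ)]
  obtain ⟨h2mΘ, hBH1, hB1, hBpos, -⟩ := eg328_prelim m hΘlow hH1 hB
  -- the comparison of constants, and `R > 1`
  have hconst := const_infinite_bound m hm1 hΘlow hH1 hL1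
  have hR1 : 1 < egC6 (m + 1) * (2 / Real.log 2) * Θ * H * L := by
    have hp : (2 : ℝ) ^ m * (1 / 2) ^ m = 1 := by rw [← mul_pow]; norm_num
    have h1 : (1 : ℝ) ≤ 2 ^ m * (Θ * H * L) := by
      calc (1 : ℝ) = 2 ^ m * (1 / 2) ^ m := hp.symm
        _ ≤ 2 ^ m * Θ := mul_le_mul_of_nonneg_left hΘlow (by positivity)
        _ = 2 ^ m * (Θ * 1 * 1) := by ring
        _ ≤ 2 ^ m * (Θ * H * L) := by
            apply mul_le_mul_of_nonneg_left _ (by positivity)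
            exact mul_le_mul (mul_le_mul_of_nonneg_left hH1 hΘpos.le) hL1 zero_le_one
              (by positivity)
    have h2 : (2 : ℝ) ^ m < 3 * 2 ^ (6 * (m + 1) + 20) := by
      have : (2 : ℝ) ^ m ≤ 2 ^ (6 * (m + 1) + 20) := pow_le_pow_right₀ one_le_two (by omega)
      have : (0 : ℝ) < 2 ^ (6 * (m + 1) + 20) := by positivity
      linarith
    have hΘHL : 0 < Θ * H * L := by positivity
    have h3 : (1 : ℝ) < 3 * 2 ^ (6 * (m + 1) + 20) * Θ * H * L := by
      calc (1 : ℝ) ≤ 2 ^ m * (Θ * H * L) := h1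
        _ < 3 * 2 ^ (6 * (m + 1) + 20) * (Θ * H * L) := mul_lt_mul_of_pos_right h2 hΘHL
        _ = _ := by ring
    linarith
  -- `Λ = P - 1` as a real number
  have hΛR : ((((∏ i, α i ^ b i) * β ^ s - 1 : ℚ)) : ℝ) = (P : ℝ) - 1 := by
    rw [hP]; push_cast; ring
  rw [hΛR]
  by_cases hbig : (1 / 2 : ℝ) < |(P : ℝ) - 1|
  · -- trivial case `|Λ| > 1/2`
    have h1 : Real.log (1 / 2) < Real.log |(P : ℝ) - 1| :=
      Real.log_lt_log (by norm_num) hbig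
    have h2 : Real.log (1 / 2) = -Real.log 2 := by
      rw [one_div, Real.log_inv]
    linarith
  push Not at hbig
  -- now `|P - 1| ≤ 1/2`, so `P ≥ 1/2 > 0`
  have hP0 : (1 / 2 : ℝ) ≤ (P : ℝ) := by linarith [(abs_le.mp hbig).1]
  have hPpos : (0 : ℝ) < (P : ℝ) := by linarith
  have hP1 : (P : ℝ) ≠ 1 := by
    intro h
    apply hΛ
    have : ((((∏ i, α i ^ b i) * β ^ s - 1 : ℚ)) : ℝ) = 0 := by rw [hΛR, h, sub_self]
    exact_mod_cast this
  have hlogP : Real.log (P : ℝ) ≠ 0 := Real.log_ne_zero_of_pos_of_ne_one hPpos hP1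
  -- the data of the linear form on `Option ι`
  set c : ℚ := |β| with hc
  have hc0 : 0 < c := abs_pos.mpr hβ
  let a : Option ι → ℚ := fun k => k.elim (if c = 1 then 2 else c) (fun i => |α i|)
  let b' : Option ι → ℤ := fun k => k.elim (if c = 1 then 0 else s) b
  let A : Option ι → ℝ := fun k => k.elim H (fun i => logHeight₁ (α i))
  have ha_some : ∀ i, a (some i) = |α i| := fun i => rfl
  have hb_some : ∀ i, b' (some i) = b i := fun i => rfl
  have hA_some : ∀ i, A (some i) = logHeight₁ (α i) := fun i => rfl
  have ha_none : a none = if c = 1 then 2 else c := rfl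
  have hb_none : b' none = if c = 1 then 0 else s := rfl
  have hA_none : A none = H := rfl
  -- the linear form equals `log P`
  have hPR : (P : ℝ) = (∏ i, ((α i : ℚ) : ℝ) ^ b i) * ((β : ℚ) : ℝ) ^ s := by
    rw [hP]; push_cast; ring
  have hαR : ∀ i, ((α i : ℚ) : ℝ) ≠ 0 := fun i => by exact_mod_cast (hα i).1
  have hβR : ((β : ℚ) : ℝ) ≠ 0 := by exact_mod_cast hβ
  have hlogabsP : Real.log (P : ℝ) =
      ∑ i, (b i : ℝ) * Real.log |((α i : ℚ) : ℝ)| + (s : ℝ) * Real.log |((β : ℚ) : ℝ)| := by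
    rw [← Real.log_abs (P : ℝ), hPR, abs_mul, Finset.abs_prod,
      Real.log_mul (Finset.prod_ne_zero_iff.mpr fun i _ => by
        rw [abs_zpow]; exact zpow_ne_zero _ (abs_ne_zero.mpr (hαR i)))
        (by rw [abs_zpow]; exact zpow_ne_zero _ (abs_ne_zero.mpr hβR)),
      Real.log_prod (s := univ) (fun i _ => by
        rw [abs_zpow]; exact zpow_ne_zero _ (abs_ne_zero.mpr (hαR i)))]
    congr 1
    · refine Finset.sum_congr rfl fun i _ => ?_
      rw [abs_zpow, Real.log_zpow]
    · rw [abs_zpow, Real.log_zpow]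
  have hnone_term : (b' none : ℝ) * Real.log ((a none : ℚ) : ℝ) =
      (s : ℝ) * Real.log |((β : ℚ) : ℝ)| := by
    rw [ha_none, hb_none]
    split_ifs with h1
    · have : |((β : ℚ) : ℝ)| = 1 := by
        rw [← Rat.cast_abs, ← hc, h1]; norm_num
      rw [this, Real.log_one]; simp
    · rw [hc, Rat.cast_abs]
  have hSum : ∑ k, (b' k : ℝ) * Real.log ((a k : ℚ) : ℝ) = Real.log (P : ℝ) := by
    rw [Fintype.sum_option, hlogabsP, hnone_term, add_comm]
    congr 1
    refine Finset.sum_congr rfl fun i _ => ?_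
    rw [hb_some, ha_some, Rat.cast_abs]
  -- hypotheses of the archimedean bound
  have hcard : 2 ≤ Fintype.card (Option ι) := by rw [Fintype.card_option]; omega
  have ha_pos : ∀ k, 0 < a k ∧ a k ≠ 1 := by
    rintro (_ | i)
    · rw [ha_none]
      split_ifs with h1
      · norm_num
      · exact ⟨hc0, h1⟩
    · rw [ha_some]
      refine ⟨abs_pos.mpr (hα i).1, ?_⟩
      intro h
      rcases (abs_eq zero_le_one).mp h with h' | h'
      · exact (hα i).2.1 h'
      · exact (hα i).2.2 h'
  have hSumne : ∑ k, (b' k : ℝ) * Real.log ((a k : ℚ) : ℝ) ≠ 0 := by rwa [hSum]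
  have hb'ne : b' ≠ 0 := by
    intro h0
    apply hSumne
    simp [h0]
  have h016 : (0.16 : ℝ) ≤ Real.log 2 := by have := Real.log_two_gt_d9; linarith
  have h016' : (0.16 : ℝ) ≤ 1 := by norm_num
  have hAk : ∀ k, max (logHeight₁ (a k)) (max |Real.log ((a k : ℚ) : ℝ)| 0.16) ≤ A k := by
    rintro (_ | i)
    · rw [ha_none, hA_none]
      split_ifs with h1
      · refine max_le ?_ (max_le ?_ ?_)
        · rw [logHeight₁_two]; linarith
        · have h2 : ((2 : ℚ) : ℝ) = 2 := by norm_num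
          rw [h2, abs_of_pos hlog2]; linarith
        · linarith
      · refine max_le ?_ (max_le ?_ ?_)
        · rw [hc, logHeight₁_abs]; exact le_max_left _ _
        · rw [hc, Rat.cast_abs]
          exact le_trans (abs_log_abs_le_logHeight₁ hβ) (le_max_left _ _)
        · linarith
    · rw [ha_some, hA_some]
      refine max_le ?_ (max_le ?_ ?_)
      · rw [logHeight₁_abs]
      · rw [Rat.cast_abs]; exact abs_log_abs_le_logHeight₁ (hα i).1
      · linarith [hhα i]
  -- `h(αᵢ) ≤ 2^m Θ ≤ B/H`
  have hhi : ∀ i, logHeight₁ (α i) ≤ 2 ^ m * Θ := by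
    intro i
    have hsplit : logHeight₁ (α i) * ∏ j ∈ univ.erase i, logHeight₁ (α j) = Θ := by
      rw [hΘ]; exact Finset.mul_prod_erase univ (fun j => logHeight₁ (α j)) (mem_univ i)
    have hrest : (1 / 2 : ℝ) ^ (m - 1) ≤ ∏ j ∈ univ.erase i, logHeight₁ (α j) := by
      have : ∏ _j ∈ univ.erase i, (1 / 2 : ℝ) = (1 / 2) ^ (m - 1) := by
        rw [Finset.prod_const, Finset.card_erase_of_mem (mem_univ i), Finset.card_univ]
      rw [← this]
      exact Finset.prod_le_prod (fun j _ => by norm_num) fun j _ => le_trans hhalf (hhα j)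
    have hhi0 : 0 ≤ logHeight₁ (α i) := zero_le_logHeight₁ _
    have h2m : (2 : ℝ) ^ m * (1 / 2) ^ (m - 1) = 2 := by
      have hk : m = (m - 1) + 1 := by omega
      calc (2 : ℝ) ^ m * (1 / 2) ^ (m - 1) = 2 ^ ((m - 1) + 1) * (1 / 2) ^ (m - 1) := by
            rw [← hk]
        _ = 2 * (2 * (1 / 2)) ^ (m - 1) := by rw [pow_succ, mul_pow]; ring
        _ = 2 := by norm_num
    calc logHeight₁ (α i) = logHeight₁ (α i) * 1 := (mul_one _).symm
      _ ≤ logHeight₁ (α i) * (2 ^ m * (1 / 2) ^ (m - 1)) := by rw [h2m]; linarith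
      _ = 2 ^ m * (logHeight₁ (α i) * (1 / 2) ^ (m - 1)) := by ring
      _ ≤ 2 ^ m * (logHeight₁ (α i) * ∏ j ∈ univ.erase i, logHeight₁ (α j)) := by
          apply mul_le_mul_of_nonneg_left _ (by positivity)
          exact mul_le_mul_of_nonneg_left hrest hhi0
      _ = 2 ^ m * Θ := by rw [hsplit]
  have hBM1 : (1 : ℝ) ≤ (B / H) ^ 2 := one_le_pow₀ hBH1
  have hBMk : ∀ k, (|b' k| : ℝ) * A k / A none ≤ (B / H) ^ 2 := by
    rintro (_ | i)
    · rw [hA_none, mul_div_assoc, div_self hH0.ne', mul_one, hb_none]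
      refine le_trans ?_ hBM1
      split_ifs
      · simp
      · rcases hs with h | h <;> simp [h]
    · rw [hb_some, hA_some, hA_none]
      have h1 : (|b i| : ℝ) * logHeight₁ (α i) ≤ B * (B / H) := by
        have := hbB i
        calc (|b i| : ℝ) * logHeight₁ (α i) ≤ B * (2 ^ m * Θ) :=
              mul_le_mul this (hhi i) (zero_le_logHeight₁ _) hBpos.le
          _ ≤ B * (B / H) := mul_le_mul_of_nonneg_left h2mΘ hBpos.le
      calc (|b i| : ℝ) * logHeight₁ (α i) / H ≤ B * (B / H) / H :=
            div_le_div_of_nonneg_right h1 hH0.le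
        _ = (B / H) ^ 2 := by ring
  -- apply the archimedean bound
  have hMat := hM (Option ι) hcard a b' A none ((B / H) ^ 2) ha_pos hb'ne hSumne hAk hBM1 hBMk
  have hprodA : ∏ k, A k = H * Θ :=
    calc ∏ k, A k = A none * ∏ i, A (some i) := Fintype.prod_option _
      _ = H * Θ := rfl
  rw [hSum, hprodA, Fintype.card_option] at hMat
  -- bound the constant and the logarithm
  have hlogBM : Real.log (Real.exp 1 * (B / H) ^ 2) ≤ 3 * L := by
    rw [Real.log_mul (Real.exp_pos 1).ne' (by positivity), Real.log_exp, Real.log_pow]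
    have h1 : Real.log (B / H) ≤ L := by
      calc Real.log (B / H) ≤ Real.log (B * 2 / H) := by
            apply Real.log_le_log (by positivity)
            rw [show B * 2 / H = 2 * (B / H) by ring]; linarith [div_pos hBpos hH0]
        _ ≤ L := le_max_right _ _
    push_cast
    linarith
  have hlogBM0 : 0 ≤ Real.log (Real.exp 1 * (B / H) ^ 2) := by
    apply Real.log_nonneg
    calc (1 : ℝ) ≤ Real.exp 1 := by linarith
      _ = Real.exp 1 * 1 := (mul_one _).symm
      _ ≤ Real.exp 1 * (B / H) ^ 2 := mul_le_mul_of_nonneg_left hBM1 (Real.exp_pos 1).le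
  -- |Λ| ≥ |log P| / 2
  have hΛlow : Real.log |Real.log (P : ℝ)| - Real.log 2 ≤ Real.log |(P : ℝ) - 1| := by
    have h1 : |Real.log (P : ℝ)| ≤ 2 * |(P : ℝ) - 1| := by
      -- `|log x| ≤ 2|x - 1|` for `|x - 1| ≤ 1/2`
      have hl1 : Real.log (P : ℝ) ≤ (P : ℝ) - 1 := Real.log_le_sub_one_of_pos hPpos
      have hl2 : 1 - (P : ℝ)⁻¹ ≤ Real.log (P : ℝ) := Real.one_sub_inv_le_log_of_pos hPpos
      rw [abs_le]
      constructor
      · have : -(2 * |(P : ℝ) - 1|) ≤ 1 - (P : ℝ)⁻¹ := by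
          rcases le_or_gt 1 (P : ℝ) with hx1 | hx1
          · have : (P : ℝ)⁻¹ ≤ 1 := inv_le_one_of_one_le₀ hx1
            have : 0 ≤ |(P : ℝ) - 1| := abs_nonneg _
            linarith
          · rw [abs_of_neg (by linarith)]
            have key : (P : ℝ)⁻¹ ≤ 3 - 2 * (P : ℝ) := by
              rw [inv_eq_one_div, div_le_iff₀ hPpos]
              nlinarith
            linarith
        linarith
      · linarith [le_abs_self ((P : ℝ) - 1), abs_nonneg ((P : ℝ) - 1)]
    have h2 : 0 < |Real.log (P : ℝ)| := abs_pos.mpr hlogP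
    have h3 : Real.log |Real.log (P : ℝ)| ≤ Real.log (2 * |(P : ℝ) - 1|) :=
      Real.log_le_log h2 h1
    rw [Real.log_mul two_ne_zero (abs_ne_zero.mpr (sub_ne_zero.mpr hP1))] at h3
    linarith
  -- generalize the constant `C₁(n, 1)` away
  suffices key : ∀ X : ℝ, X ≤ 2 ^ (6 * (m + 1) + 20) → 0 ≤ X →
      -(X * (H * Θ) * Real.log (Real.exp 1 * (B / H) ^ 2)) < Real.log |Real.log (P : ℝ)| →
      -(egC6 (m + 1) * (2 / Real.log 2) * Θ * H * L) < Real.log |(P : ℝ) - 1| by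
    exact key (C (m + 1)) (hCle (m + 1) (by omega)) (hC0 (m + 1) (by omega)) hMat
  intro X hXle hX0 hMat'
  have hmain : X * (H * Θ) * Real.log (Real.exp 1 * (B / H) ^ 2) ≤
      3 * 2 ^ (6 * (m + 1) + 20) * Θ * H * L := by
    calc X * (H * Θ) * Real.log (Real.exp 1 * (B / H) ^ 2)
        ≤ 2 ^ (6 * (m + 1) + 20) * (H * Θ) * (3 * L) := by
          apply mul_le_mul _ hlogBM hlogBM0 (by positivity)
          exact mul_le_mul_of_nonneg_right hXle (by positivity)
      _ = _ := by ring
  linarith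

/-! ### The finite places, from a `p`-adic bound of Yu's shape with a generic constant -/

/-- **Evertse–Győry, Theorem 3.2.8 for `K = ℚ` at a finite place `p`, from a `p`-adic upper bound
of the shape of Theorem 3.2.7 (Yu 2007) over `ℚ` with ANY constant `C₃(n)` such that
`C₃(n) · 7(n+1)² ≤ C₆(n, 1)`.**

The hypothesis `hY` is the statement of Theorem 3.2.7 (p. 62) for `K = ℚ` exactly as in
`thm328_rat_finite_of_yu` (`d = 1`, `𝔭 = p`, `e_𝔭 = f_𝔭 = 1`, `N(𝔭) = p`; `h'ᵢ = max{h(αᵢ), 1/(16e²)}`,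
`C₄(n,1) = 2^{2n+1} log 2 (log 3)³`, `M = Bₙ C₅(n,1) p^{n+1} h'₁⋯h'ₙ₋₁`,
`C₅(n,1) = 2e^{(n+1)(6n+5)} log 2`, any `0 < δ ≤ ½`), except that the printed constant
`C₃(n,1) = (16e)^{2(n+1)} n^{3/2} log(2n) log 2` in front of `p/(log p)²` is replaced by a parameter
`C₃(n)` subject only to `0 ≤ C₃(n)` and `C₃(n) · 7(n+1)² ≤ C₆(n,1) = λ(16e)^{3n+2}` for `n ≥ 2`
(for the printed `C₃` this is `const_finite_bound`). The conclusion is the finite-place half of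
Theorem 3.2.8 for `K = ℚ`; the proof is that of `thm328_rat_finite_of_yu` (p. 63: `Bₙ = 1`,
`δ = ΘH/B`, `finite_place_computation`).
[cite: EvertseGyory2015, Thm 3.2.7 (p. 62), Thm 3.2.8 (p. 62), proof p. 63] -/
theorem thm328_rat_finite_of_padicBound (C₃ : ℕ → ℝ) (hC₃0 : ∀ n, 2 ≤ n → 0 ≤ C₃ n)
    (hC₃le : ∀ n, 2 ≤ n → C₃ n * (7 * ((n : ℝ) + 1) ^ 2) ≤ egC6 n)
    (hY : ∀ (κ : Type) [Fintype κ] [DecidableEq κ], 2 ≤ Fintype.card κ →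
      ∀ (α : κ → ℚ) (b : κ → ℤ) (k₀ : κ) (B Bn δ : ℝ) (p : ℕ), p.Prime →
        (∀ k, α k ≠ 0) → b k₀ ≠ 0 →
        (∀ k, b k ≠ 0 → padicValInt p (b k₀) ≤ padicValInt p (b k)) →
        (∀ k, (|b k| : ℝ) ≤ B) → Bn ≤ B → (|b k₀| : ℝ) ≤ Bn →
        ∏ k, α k ^ b k - 1 ≠ 0 → 0 < δ → δ ≤ 1 / 2 →
        (padicValRat p (∏ k, α k ^ b k - 1) : ℝ) <
          C₃ (Fintype.card κ) * (p / Real.log p ^ 2) *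
            max ((∏ k, max (logHeight₁ (α k)) (1 / (16 * Real.exp 1 ^ 2))) *
                  Real.log (Bn * (2 * Real.exp 1 ^ ((Fintype.card κ + 1) *
                      (6 * Fintype.card κ + 5)) * Real.log 2) * (p : ℝ) ^ (Fintype.card κ + 1) *
                    (∏ k ∈ univ.erase k₀, max (logHeight₁ (α k)) (1 / (16 * Real.exp 1 ^ 2))) /
                    δ))
              (δ * B / (Bn * (2 ^ (2 * Fintype.card κ + 1) * Real.log 2 * Real.log 3 ^ 3))))
    (ι : Type) [Fintype ι] (hι : 0 < Fintype.card ι)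
    (α : ι → ℚ) (hα : ∀ i, α i ≠ 0 ∧ α i ≠ 1 ∧ α i ≠ -1)
    (β : ℚ) (hβ : β ≠ 0) (s : ℤ) (hs : s = 1 ∨ s = -1) (b : ι → ℤ)
    (hΛ : (∏ i, α i ^ b i) * β ^ s - 1 ≠ 0)
    (B : ℝ) (hbB : ∀ i, (|b i| : ℝ) ≤ B)
    (hB : 2 * Real.exp 1 * 9 ^ (Fintype.card ι + 1) * (∏ i, logHeight₁ (α i)) *
        max (logHeight₁ β) 1 ≤ B)
    (p : ℕ) (hp : p.Prime) :
    -(egC6 (Fintype.card ι + 1) * (p / Real.log p) * (∏ i, logHeight₁ (α i)) *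
          max (logHeight₁ β) 1 * logStar (B * p / max (logHeight₁ β) 1)) <
      -(padicValRat p ((∏ i, α i ^ b i) * β ^ s - 1) : ℝ) * Real.log p := by
  classical
  set m := Fintype.card ι with hm
  set Θ := ∏ i, logHeight₁ (α i) with hΘ
  set H := max (logHeight₁ β) 1 with hH
  have hlog2 : 0 < Real.log 2 := Real.log_pos one_lt_two
  have hl2 : Real.log 2 ≤ 1 := by have := Real.log_two_lt_d9; linarith
  have hhalf : (1 / 2 : ℝ) ≤ Real.log 2 := by have := Real.log_two_gt_d9; linarith
  have hhα : ∀ i, Real.log 2 ≤ logHeight₁ (α i) := fun i =>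
    log_two_le_logHeight₁ (hα i).1 (hα i).2.1 (hα i).2.2
  have hΘlow : (1 / 2 : ℝ) ^ m ≤ Θ := half_pow_card_le_prod_logHeight₁ α hα
  have hΘpos : 0 < Θ := lt_of_lt_of_le (by positivity) hΘlow
  have hH1 : 1 ≤ H := le_max_right _ _
  have hH0 : 0 < H := by linarith
  have he2 : (2 : ℝ) ≤ Real.exp 1 := by linarith [Real.add_one_le_exp (1 : ℝ)]
  obtain ⟨-, hBH1, hB1, hBpos, h2ΘH⟩ := eg328_prelim m hΘlow hH1 hB
  -- the data of the `p`-adic bound on `Option ι`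
  let α' : Option ι → ℚ := fun k => k.elim β α
  let b' : Option ι → ℤ := fun k => k.elim s b
  have hα'_none : α' none = β := rfl
  have hb'_none : b' none = s := rfl
  have hcard : 2 ≤ Fintype.card (Option ι) := by rw [Fintype.card_option]; omega
  have hα' : ∀ k, α' k ≠ 0 := by
    rintro (_ | i)
    · exact hβ
    · exact (hα i).1
  have hs0 : s ≠ 0 := by rcases hs with h | h <;> simp [h]
  have hb'0 : b' none ≠ 0 := hs0
  have hord : ∀ k, b' k ≠ 0 → padicValInt p (b' none) ≤ padicValInt p (b' k) := by
    intro k _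
    have : padicValInt p (b' none) = 0 := by
      rw [hb'_none]
      rcases hs with h | h <;> simp [h, padicValInt]
    rw [this]; exact Nat.zero_le _
  have hb'B : ∀ k, (|b' k| : ℝ) ≤ B := by
    rintro (_ | i)
    · rw [hb'_none]
      rcases hs with h | h <;> simp [h] <;> exact hB1
    · exact hbB i
  have hbn : (|b' none| : ℝ) ≤ 1 := by
    rw [hb'_none]
    rcases hs with h | h <;> simp [h]
  have hprodΛ : ∏ k, α' k ^ b' k - 1 = (∏ i, α i ^ b i) * β ^ s - 1 := by
    rw [Fintype.prod_option]
    show β ^ s * (∏ i, α i ^ b i) - 1 = _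
    rw [mul_comm]
  have hΛ' : ∏ k, α' k ^ b' k - 1 ≠ 0 := by rwa [hprodΛ]
  have hδ0 : 0 < Θ * H / B := by positivity
  have hδhalf : Θ * H / B ≤ 1 / 2 := by
    rw [div_le_iff₀ hBpos]; linarith
  -- apply the `p`-adic bound
  have hYu := hY (Option ι) hcard α' b' none B 1 (Θ * H / B) p hp hα' hb'0 hord hb'B hB1 hbn hΛ'
    hδ0 hδhalf
  -- the heights `h'`
  have h16 : 1 / (16 * Real.exp 1 ^ 2) ≤ Real.log 2 := by
    have h4 : (4 : ℝ) ≤ Real.exp 1 ^ 2 := by nlinarith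
    calc 1 / (16 * Real.exp 1 ^ 2) ≤ 1 / (16 * 4) := by
          apply one_div_le_one_div_of_le (by norm_num); linarith
      _ ≤ 1 / 2 := by norm_num
      _ ≤ Real.log 2 := hhalf
  have hh'some : ∀ i, max (logHeight₁ (α' (some i))) (1 / (16 * Real.exp 1 ^ 2)) =
      logHeight₁ (α i) := fun i => max_eq_left (le_trans h16 (hhα i))
  have hh'none : max (logHeight₁ (α' none)) (1 / (16 * Real.exp 1 ^ 2)) ≤ H := by
    rw [hα'_none]
    exact max_le (le_max_left _ _) (le_trans (le_trans h16 hl2) hH1)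
  have hh'none0 : 0 < max (logHeight₁ (α' none)) (1 / (16 * Real.exp 1 ^ 2)) :=
    lt_max_of_lt_right (by positivity)
  have hprodh' : ∏ k, max (logHeight₁ (α' k)) (1 / (16 * Real.exp 1 ^ 2)) =
      max (logHeight₁ (α' none)) (1 / (16 * Real.exp 1 ^ 2)) * Θ := by
    rw [Fintype.prod_option]
    congr 1
    exact Finset.prod_congr rfl fun i _ => hh'some i
  have hprod_erase :
      ∏ k ∈ univ.erase none, max (logHeight₁ (α' k)) (1 / (16 * Real.exp 1 ^ 2)) = Θ := by
    have h := Finset.prod_erase_mul (univ : Finset (Option ι))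
      (fun k => max (logHeight₁ (α' k)) (1 / (16 * Real.exp 1 ^ 2))) (mem_univ none)
    rw [hprodh'] at h
    exact mul_right_cancel₀ hh'none0.ne' (h.trans (mul_comm _ _))
  rw [hprodΛ, hprodh', hprod_erase] at hYu
  -- from now on `n = #ι + 1 = card (Option ι)`
  obtain ⟨n, hn⟩ : ∃ n : ℕ, Fintype.card (Option ι) = n := ⟨_, rfl⟩
  have hnm : n = m + 1 := by rw [← hn, Fintype.card_option]
  have hn2 : 2 ≤ n := hn ▸ hcard
  rw [hn] at hYu
  have key := finite_place_computation n hp.two_le hΘpos hH1 hBH1 hBpos hh'none0 hh'none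
    (hC₃0 n hn2) (hC₃le n hn2) (yuC5_pos n) (log_yuC5_le n) (one_le_yuC4 n hn2) hYu
  rw [← hnm]
  linarith

/-! ### Assembly -/

/-- **Evertse–Győry, Theorem 4.2.1 for `K = ℚ` from an archimedean and a `p`-adic bound with generic
constants.** If linear forms in logarithms of positive rationals satisfy the lower bound of Theorem
3.2.4 over `ℚ` with some constant `0 ≤ C(n) ≤ 2^{6n+20}`, and `p`-adic valuations of
`α₁^{b₁}⋯αₙ^{bₙ} − 1` (`αᵢ ∈ ℚ*`) satisfy the upper bound of Theorem 3.2.7 over `ℚ` with some constant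
`0 ≤ C₃(n)`, `C₃(n) · 7(n+1)² ≤ C₆(n,1)` (both for `n ≥ 2`), then the named fact
`evertseGyory_thm_4_2_1_rat` holds: Theorem 3.2.8 over `ℚ` by the two theorems above, then the
book's §4.4 (`evertseGyory_thm_4_2_1_rat_of_thm_3_2_8`). With `C = C₁(·,1)` and `C₃ = C₃(·,1)` this
is `evertseGyory_thm_4_2_1_rat_of_matveev_yu`.
[cite: EvertseGyory2015, Thm 3.2.8 (p. 62), proof p. 63, Thm 4.2.1 (p. 68)] -/
theorem evertseGyory_thm_4_2_1_rat_of_archBound_padicBound (C C₃ : ℕ → ℝ)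
    (hC0 : ∀ n, 2 ≤ n → 0 ≤ C n) (hCle : ∀ n, 2 ≤ n → C n ≤ 2 ^ (6 * n + 20))
    (hC₃0 : ∀ n, 2 ≤ n → 0 ≤ C₃ n)
    (hC₃le : ∀ n, 2 ≤ n → C₃ n * (7 * ((n : ℝ) + 1) ^ 2) ≤ egC6 n)
    (hM : ∀ (κ : Type) [Fintype κ], 2 ≤ Fintype.card κ →
      ∀ (a : κ → ℚ) (b : κ → ℤ) (A : κ → ℝ) (k₀ : κ) (B : ℝ),
        (∀ k, 0 < a k ∧ a k ≠ 1) → b ≠ 0 →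
        ∑ k, (b k : ℝ) * Real.log (a k : ℝ) ≠ 0 →
        (∀ k, max (logHeight₁ (a k)) (max |Real.log (a k : ℝ)| 0.16) ≤ A k) →
        1 ≤ B → (∀ k, (|b k| : ℝ) * A k / A k₀ ≤ B) →
        -(C (Fintype.card κ) * (∏ k, A k) * Real.log (Real.exp 1 * B)) <
          Real.log |∑ k, (b k : ℝ) * Real.log (a k : ℝ)|)
    (hY : ∀ (κ : Type) [Fintype κ] [DecidableEq κ], 2 ≤ Fintype.card κ →
      ∀ (α : κ → ℚ) (b : κ → ℤ) (k₀ : κ) (B Bn δ : ℝ) (p : ℕ), p.Prime →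
        (∀ k, α k ≠ 0) → b k₀ ≠ 0 →
        (∀ k, b k ≠ 0 → padicValInt p (b k₀) ≤ padicValInt p (b k)) →
        (∀ k, (|b k| : ℝ) ≤ B) → Bn ≤ B → (|b k₀| : ℝ) ≤ Bn →
        ∏ k, α k ^ b k - 1 ≠ 0 → 0 < δ → δ ≤ 1 / 2 →
        (padicValRat p (∏ k, α k ^ b k - 1) : ℝ) <
          C₃ (Fintype.card κ) * (p / Real.log p ^ 2) *
            max ((∏ k, max (logHeight₁ (α k)) (1 / (16 * Real.exp 1 ^ 2))) *
                  Real.log (Bn * (2 * Real.exp 1 ^ ((Fintype.card κ + 1) *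
                      (6 * Fintype.card κ + 5)) * Real.log 2) * (p : ℝ) ^ (Fintype.card κ + 1) *
                    (∏ k ∈ univ.erase k₀, max (logHeight₁ (α k)) (1 / (16 * Real.exp 1 ^ 2))) /
                    δ))
              (δ * B / (Bn * (2 ^ (2 * Fintype.card κ + 1) * Real.log 2 * Real.log 3 ^ 3)))) :
    evertseGyory_thm_4_2_1_rat :=
  evertseGyory_thm_4_2_1_rat_of_thm_3_2_8 fun ι _ hι α hα β hβ s hs b hΛ B hbB hB =>
    ⟨thm328_rat_infinite_of_archBound C hC0 hCle hM ι hι α hα β hβ s hs b hΛ B hbB hB,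
      fun p hp =>
        thm328_rat_finite_of_padicBound C₃ hC₃0 hC₃le hY ι hι α hα β hβ s hs b hΛ B hbB hB p hp⟩

/-- **The weak branch of Matveev's constant suffices.** The named fact `evertseGyory_thm_4_2_1_rat`
follows from (i) the lower bound `log |b₁ log a₁ + ⋯ + bₙ log aₙ| > −2^{6n+20} A₁⋯Aₙ log(eB)` for
positive rationals `aₖ ≠ 1` (the hypotheses on `Aₖ`, `B` being those of Theorem 3.2.4 for `K = ℚ`;
this is the second expression `2^{6n+20}` of the printed `C₁(n, 1)`, WITHOUT Matveev's sharper
`(en/2) 30^{n+3} n^{3.5}`), and (ii) Theorem 3.2.7 (Yu 2007) for `K = ℚ` as printed (the hypothesis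
`hY` of `thm328_rat_finite_of_yu`). Immediate from
`evertseGyory_thm_4_2_1_rat_of_archBound_padicBound` with `C(n) = 2^{6n+20}`,
`C₃(n) = (16e)^{2(n+1)} n^{3/2} log(2n) log 2` (`yuC3_nonneg`, `const_finite_bound`).
[cite: EvertseGyory2015, Thm 3.2.4 (p. 61), Thm 3.2.7 (p. 62), Thm 4.2.1 (p. 68)] -/
theorem evertseGyory_thm_4_2_1_rat_of_weakMatveev_yu
    (hM : ∀ (κ : Type) [Fintype κ], 2 ≤ Fintype.card κ →
      ∀ (a : κ → ℚ) (b : κ → ℤ) (A : κ → ℝ) (k₀ : κ) (B : ℝ),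
        (∀ k, 0 < a k ∧ a k ≠ 1) → b ≠ 0 →
        ∑ k, (b k : ℝ) * Real.log (a k : ℝ) ≠ 0 →
        (∀ k, max (logHeight₁ (a k)) (max |Real.log (a k : ℝ)| 0.16) ≤ A k) →
        1 ≤ B → (∀ k, (|b k| : ℝ) * A k / A k₀ ≤ B) →
        -((2 : ℝ) ^ (6 * Fintype.card κ + 20) * (∏ k, A k) * Real.log (Real.exp 1 * B)) <
          Real.log |∑ k, (b k : ℝ) * Real.log (a k : ℝ)|)
    (hY : ∀ (κ : Type) [Fintype κ] [DecidableEq κ], 2 ≤ Fintype.card κ →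
      ∀ (α : κ → ℚ) (b : κ → ℤ) (k₀ : κ) (B Bn δ : ℝ) (p : ℕ), p.Prime →
        (∀ k, α k ≠ 0) → b k₀ ≠ 0 →
        (∀ k, b k ≠ 0 → padicValInt p (b k₀) ≤ padicValInt p (b k)) →
        (∀ k, (|b k| : ℝ) ≤ B) → Bn ≤ B → (|b k₀| : ℝ) ≤ Bn →
        ∏ k, α k ^ b k - 1 ≠ 0 → 0 < δ → δ ≤ 1 / 2 →
        (padicValRat p (∏ k, α k ^ b k - 1) : ℝ) <
          (16 * Real.exp 1) ^ (2 * (Fintype.card κ + 1)) * (Fintype.card κ : ℝ) ^ (3 / 2 : ℝ) *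
              Real.log (2 * Fintype.card κ) * Real.log 2 *
            (p / Real.log p ^ 2) *
            max ((∏ k, max (logHeight₁ (α k)) (1 / (16 * Real.exp 1 ^ 2))) *
                  Real.log (Bn * (2 * Real.exp 1 ^ ((Fintype.card κ + 1) *
                      (6 * Fintype.card κ + 5)) * Real.log 2) * (p : ℝ) ^ (Fintype.card κ + 1) *
                    (∏ k ∈ univ.erase k₀, max (logHeight₁ (α k)) (1 / (16 * Real.exp 1 ^ 2))) /
                    δ))
              (δ * B / (Bn * (2 ^ (2 * Fintype.card κ + 1) * Real.log 2 * Real.log 3 ^ 3)))) :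
    evertseGyory_thm_4_2_1_rat :=
  evertseGyory_thm_4_2_1_rat_of_archBound_padicBound (fun n => (2 : ℝ) ^ (6 * n + 20))
    (fun n => (16 * Real.exp 1) ^ (2 * (n + 1)) * (n : ℝ) ^ (3 / 2 : ℝ) * Real.log (2 * n) *
      Real.log 2)
    (fun n _ => by positivity) (fun n _ => le_rfl)
    (fun n hn => yuC3_nonneg n (le_trans one_le_two hn)) (fun n hn => const_finite_bound n hn)
    hM hY

/-- Conversely to the remark in the module docstring: the printed hypothesis `hM` of
`evertseGyory_thm_4_2_1_rat_of_matveev_yu` (constant `min{(en/2) 30^{n+3} n^{3.5}, 2^{6n+20}}`)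
implies the weak one (constant `2^{6n+20}`), since `min{X, Y} ≤ Y` and the other factors are
non-negative whenever the bound is not vacuous. Hence the tree's reduction is the special case
`C = C₁(·, 1)` of `evertseGyory_thm_4_2_1_rat_of_archBound_padicBound`. [folklore] -/
theorem archBound_weak_of_matveev
    (hM : ∀ (κ : Type) [Fintype κ], 2 ≤ Fintype.card κ →
      ∀ (a : κ → ℚ) (b : κ → ℤ) (A : κ → ℝ) (k₀ : κ) (B : ℝ),
        (∀ k, 0 < a k ∧ a k ≠ 1) → b ≠ 0 →
        ∑ k, (b k : ℝ) * Real.log (a k : ℝ) ≠ 0 →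
        (∀ k, max (logHeight₁ (a k)) (max |Real.log (a k : ℝ)| 0.16) ≤ A k) →
        1 ≤ B → (∀ k, (|b k| : ℝ) * A k / A k₀ ≤ B) →
        -(min (Real.exp 1 * Fintype.card κ / 2 * 30 ^ (Fintype.card κ + 3) *
                (Fintype.card κ : ℝ) ^ (7 / 2 : ℝ))
              (2 ^ (6 * Fintype.card κ + 20)) *
            (∏ k, A k) * Real.log (Real.exp 1 * B)) <
          Real.log |∑ k, (b k : ℝ) * Real.log (a k : ℝ)|)
    (κ : Type) [Fintype κ] (hκ : 2 ≤ Fintype.card κ)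
    (a : κ → ℚ) (b : κ → ℤ) (A : κ → ℝ) (k₀ : κ) (B : ℝ)
    (ha : ∀ k, 0 < a k ∧ a k ≠ 1) (hb : b ≠ 0)
    (hSum : ∑ k, (b k : ℝ) * Real.log (a k : ℝ) ≠ 0)
    (hA : ∀ k, max (logHeight₁ (a k)) (max |Real.log (a k : ℝ)| 0.16) ≤ A k)
    (hB1 : 1 ≤ B) (hBk : ∀ k, (|b k| : ℝ) * A k / A k₀ ≤ B) :
    -((2 : ℝ) ^ (6 * Fintype.card κ + 20) * (∏ k, A k) * Real.log (Real.exp 1 * B)) <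
      Real.log |∑ k, (b k : ℝ) * Real.log (a k : ℝ)| := by
  have h := hM κ hκ a b A k₀ B ha hb hSum hA hB1 hBk
  have hA0 : 0 ≤ ∏ k, A k :=
    Finset.prod_nonneg fun k _ => le_trans (le_trans (by norm_num) (le_max_right _ _))
      (le_trans (le_max_right _ _) (hA k))
  have hlog0 : 0 ≤ Real.log (Real.exp 1 * B) := by
    apply Real.log_nonneg
    calc (1 : ℝ) ≤ Real.exp 1 := by linarith [Real.add_one_le_exp (1 : ℝ)]
      _ = Real.exp 1 * 1 := (mul_one _).symm
      _ ≤ Real.exp 1 * B := mul_le_mul_of_nonneg_left hB1 (Real.exp_pos 1).le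
  have hmin : min (Real.exp 1 * Fintype.card κ / 2 * 30 ^ (Fintype.card κ + 3) *
        (Fintype.card κ : ℝ) ^ (7 / 2 : ℝ)) (2 ^ (6 * Fintype.card κ + 20)) ≤
      (2 : ℝ) ^ (6 * Fintype.card κ + 20) := min_le_right _ _
  have hprod : min (Real.exp 1 * Fintype.card κ / 2 * 30 ^ (Fintype.card κ + 3) *
        (Fintype.card κ : ℝ) ^ (7 / 2 : ℝ)) (2 ^ (6 * Fintype.card κ + 20)) *
        (∏ k, A k) * Real.log (Real.exp 1 * B) ≤
      (2 : ℝ) ^ (6 * Fintype.card κ + 20) * (∏ k, A k) * Real.log (Real.exp 1 * B) :=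
    mul_le_mul_of_nonneg_right (mul_le_mul_of_nonneg_right hmin hA0) hlog0
  linarith

end Literature.NumberTheory.DiophantineGeometry.Dioph

end
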